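import Mathlib
import Literature.Analysis.FluidPDE.PeriodicNSOrbitPersistsProofs
import Literature.Analysis.FluidPDE.GalerkinFlow
import Summits.AnomalousDissipation.AnomalousDissipation.Theorems.WazewskiBlockUniformWorkFloorTrapStubCoeffCurveODELattice
import HarnessLib

/-!
# Route `WazewskiBlock`, crux `UniformWorkFloorTrap` (stmt-AnomalousDissipation-10353), line
# `work-lipschitz-cycles`: the registered stub `stub_coeffCurveODE` (time-Fourier dictionary)

Definition-free proof file (lead a1).  The registered sub-stub S4 of the reshaped line skeleton
`Cruxes/UniformWorkFloorTrap/Lines/work_lipschitz_cycles.lean`: a transversal conjugate-symmetric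
lattice family `c(n,k)` vanishing on the zero spatial modes and off `|k|² ≤ N²`, with rapidly
decaying extension, solving the spatially truncated projected space–time lattice equation, has the
time-summed coefficient curve `α(t) = (∑ₙ eₙ(ωt) c(n,k))_{|k|² ≤ N²}` continuous and solving the
Galerkin ODE `α' = galerkinRHS (freqBall N) ν f̂ α` of `Literature.Analysis.FluidPDE.GalerkinFlow`
at every time.  Assembly of `…StubCoeffCurveODETools` (termwise differentiation) and
`…StubCoeffCurveODELattice` (summed lattice equation, Cauchy product):
`timeSum_deriv_eq_galerkinRHS` identifies the summed equation with the Galerkin vector field mode by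
mode (`Torus.lerayCoeff = Torus.leraySym` off `k = 0`, `Π_k f̂(k) = f̂(k)` for divergence-free
`f`, the zero mode by transversality and `∫ f = 0`), and `hasDerivAt_pi` assembles the curve.

References: Constantin–Foias 1988, Ch. 8, (8.5); Robinson–Rodrigo–Sadowski 2016, Thm. 4.4 Step 1,
(4.5) (the Galerkin system in Fourier variables).
-/

noncomputable section

-- `Summit.<Summit>.<Problem>`: single-conjunct summit, the duplicate namespace is mandated (CONVENTIONS §2).
set_option linter.dupNamespace false

namespace Summit.AnomalousDissipation.AnomalousDissipation.Theorems.UniformWorkFloorTrap.WorkLipschitzCycles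

open scoped Topology ComplexConjugate
open Filter Set Function
open Literature.Analysis.FunctionSpaces Literature.Analysis.FunctionSpaces.Torus

section Deriv

open MeasureTheory UnitAddTorus
open scoped ENNReal
open Literature.Analysis.FunctionSpaces.EuclideanSpace
open Literature.Analysis.FluidPDE Literature.Analysis.FluidPDE.ScalarFourier
open Literature.Analysis.FluidPDE.TimePeriodicLattice

variable {c : ℤ × (Fin 3 → ℤ) → EuclideanSpace ℂ (Fin 3)} {N : ℕ} {ω ν : ℝ}
  {f : UnitAddTorus (Fin 3) → EuclideanSpace ℝ (Fin 3)}

/-! ## §1 The derivative identity, mode by mode -/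

/-- **The summed lattice equation is the Galerkin vector field**: at every mode `k` of the ball,
`∑ₙ eₙ(ωt) (2πiωn) c(n,k) = galerkinRHS (freqBall N) ν f̂ 𝐚 (k)`. [folklore] -/
theorem timeSum_deriv_eq_galerkinRHS (hf : IsGalerkinMode N f) (hf0 : HasZeroMean f)
    (hc0 : ∀ n : ℤ, c (n, 0) = 0)
    (hct : ∀ m : ℤ × (Fin 3 → ℤ), (∑ jj : Fin 3, ((m.2 jj : ℤ) : ℂ) * (c m) jj) = 0)
    (hcN : ∀ m : ℤ × (Fin 3 → ℤ), (N : ℝ) ^ 2 < freqNormSq m.2 → c m = 0)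
    (hcr : RapidDecay ((fun K : Fin 4 → ℤ => c ((K 0, Fin.tail K) : ℤ × (Fin 3 → ℤ)))))
    (heq : ∀ m : ℤ × (Fin 3 → ℤ), m.2 ≠ 0 → freqNormSq m.2 ≤ (N : ℝ) ^ 2 →
      (2 * Real.pi * Complex.I * (ω : ℂ) * (m.1 : ℂ) + ((4 * Real.pi ^ 2 * ν * freqNormSq m.2 : ℝ) : ℂ)) • c m +
        Torus.lerayCoeff m.2 ((WithLp.toLp 2 (fun p : Fin 3 => ∑ j : Fin 3, ∑' m' : ℤ × (Fin 3 → ℤ), c m' j * (dsym j (Prod.snd m - Prod.snd m') * c (m - m') p)) : EuclideanSpace ℂ (Fin 3))) = if m.1 = 0 then mFourierCoeff (complexify ∘ f) m.2 else 0)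
    (x : UnitAddCircle) (k : ↥(freqBall N : Finset (Fin 3 → ℤ))) :
    (∑' n : ℤ, (fourier n x : ℂ) • ((2 * Real.pi * Complex.I * ω * n) • c (n, (k : Fin 3 → ℤ)))) =
      galerkinRHS (freqBall N) ν (fourierRestrict (freqBall N) f)
        (fun k' : ↥(freqBall N : Finset (Fin 3 → ℤ)) => (fun l : Fin 3 → ℤ => ∑' n : ℤ, (fourier n x : ℂ) • c (n, l)) (k' : Fin 3 → ℤ)) k := by
  have hk : freqNormSq (k : Fin 3 → ℤ) ≤ (N : ℝ) ^ 2 := mem_freqBall.1 k.2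
  rw [lattice_eq_timeSum hf hf0 hc0 hct hcr heq hk x (summable_norm_nl_fibre hcN hcr _),
    tsum_fourier_smul_nl_eq_convectionCoeff hcN hcr x, galerkinRHS_apply, Torus.galerkinField_def,
    coeffExt_timeSum_eq hcN x, coeffExt_coe, fourierRestrict_apply, Torus.leraySym_sub]
  by_cases hk0 : (k : Fin 3 → ℤ) = 0
  · -- the zero mode: every term vanishes
    have ha0 : (fun l : Fin 3 → ℤ => ∑' n : ℤ, (fourier n x : ℂ) • c (n, l)) (k : Fin 3 → ℤ) = 0 := by
      rw [hk0]; exact tsum_fourier_smul_eq_zero_of_forall hc0 x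
    have hconv0 : Torus.convectionCoeff (freqBall N) (fun l : Fin 3 → ℤ => ∑' n : ℤ, (fourier n x : ℂ) • c (n, l)) (fun l : Fin 3 → ℤ => ∑' n : ℤ, (fourier n x : ℂ) • c (n, l)) (k : Fin 3 → ℤ) = 0 := by
      rw [← tsum_fourier_smul_nl_eq_convectionCoeff hcN hcr x, hk0]
      have : ∀ n : ℤ, (WithLp.toLp 2 (fun p : Fin 3 => ∑ j : Fin 3, ∑' m' : ℤ × (Fin 3 → ℤ), c m' j * (dsym j (Prod.snd ((n, 0) : ℤ × (Fin 3 → ℤ)) - Prod.snd m') * c (((n, 0) : ℤ × (Fin 3 → ℤ)) - m') p)) : EuclideanSpace ℂ (Fin 3)) = 0 := fun n => nl_cons_zero_of_rapidDecayE hct hcr hcr n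
      simp only [this, smul_zero, tsum_zero]
    rw [ha0, hconv0, hk0, mFourierCoeff_zero_of_hasZeroMean hf.isSmooth hf0]
    simp
  · have htr : (∑ i : Fin 3, (((k : Fin 3 → ℤ) i : ℤ) : ℂ) * mFourierCoeff (complexify ∘ f) (k : Fin 3 → ℤ) i) = 0 :=
      hf.isDivFree.sum_mul_mFourierCoeff_eq_zero hf.isSmooth _
    rw [Torus.leraySym_of_transversal htr, Torus.lerayCoeff_of_ne_zero hk0]
    have hscal : (((4 * Real.pi ^ 2 * ν * freqNormSq (k : Fin 3 → ℤ) : ℝ)) : ℂ) =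
        (((ν * (4 * Real.pi ^ 2 * freqNormSq (k : Fin 3 → ℤ)) : ℝ)) : ℂ) := by
      congr 1; ring
    rw [hscal]
    abel

end Deriv

/-! ## §2 The registered stub -/

section Stub

open MeasureTheory UnitAddTorus
open Literature.Analysis.FunctionSpaces.EuclideanSpace
open Literature.Analysis.FluidPDE Literature.Analysis.FluidPDE.ScalarFourier
open Literature.Analysis.FluidPDE.TimePeriodicLattice

/-- The flat three-torus. -/
local notation "𝕋³" => UnitAddTorus (Fin 3)
/-- Velocity values on `T³`. -/
local notation "E³" => EuclideanSpace ℝ (Fin 3)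
/-- Complexified velocity values. -/
local notation "ℂ³" => EuclideanSpace ℂ (Fin 3)

/-- **S4 · The time-Fourier dictionary: a truncated lattice solution solves the Galerkin ODE**
(registered stub `stub_coeffCurveODE` of the line `work-lipschitz-cycles` of crux
`WazewskiBlock.UniformWorkFloorTrap`; the Galerkin twin of `TimePeriodicLattice.realize_nonlinear`).
Let `c` be a transversal conjugate-symmetric lattice family vanishing on the zero spatial modes and
off `|k|² ≤ N²`, with rapidly decaying extension, solving the TRUNCATED projected lattice equation
`(2πiωn + 4π²ν|k|²) c(n,k) + Π_k N(c,c)(n,k) = [n = 0] f̂(k)` on `0 < |k|² ≤ N²` for a mean-zero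
Galerkin-mode force `f` of order `N`. Then the time-summed coefficient curve
`α(t) = (∑ₙ eₙ(ωt) c(n,k))_{|k|² ≤ N²}` is continuous and solves the Galerkin ODE
`α' = galerkinRHS (freqBall N) ν f̂ α` at every time: termwise differentiation
(`hasDerivAt_tsum_fourier_smul`), the summed lattice equation (`lattice_eq_timeSum`), the Cauchy
product (`tsum_fourier_smul_nl_eq_convectionCoeff`), `Torus.lerayCoeff = Torus.leraySym` off
`k = 0`, `Π_k f̂(k) = f̂(k)` for divergence-free `f`, and the zero mode by transversality and
`∫ f = 0` (Constantin–Foias 1988, Ch. 8, (8.5): the Galerkin system in Fourier variables). [folklore] -/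
theorem stub_coeffCurveODE (c : ℤ × (Fin 3 → ℤ) → ℂ³) (N : ℕ) (ω ν : ℝ) (f : 𝕋³ → E³)
    (hω : 0 < ω) (hf : IsGalerkinMode N f) (hf0 : HasZeroMean f)
    (hc0 : ∀ n : ℤ, c (n, 0) = 0)
    (hct : ∀ m : ℤ × (Fin 3 → ℤ), (∑ jj : Fin 3, ((m.2 jj : ℤ) : ℂ) * (c m) jj) = 0)
    (hcs : ∀ m, c (-m) = conjVec (c m))
    (hcN : ∀ m : ℤ × (Fin 3 → ℤ), (N : ℝ) ^ 2 < freqNormSq m.2 → c m = 0)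
    (hcr : RapidDecay (fun K : Fin 4 → ℤ => c (K 0, Fin.tail K)))
    (heq : ∀ m : ℤ × (Fin 3 → ℤ), m.2 ≠ 0 → freqNormSq m.2 ≤ (N : ℝ) ^ 2 →
      (2 * Real.pi * Complex.I * (ω : ℂ) * (m.1 : ℂ) + ((4 * Real.pi ^ 2 * ν * freqNormSq m.2 : ℝ) : ℂ)) • c m +
        Torus.lerayCoeff m.2 (WithLp.toLp 2 (fun p : Fin 3 => ∑ j : Fin 3, ∑' m' : ℤ × (Fin 3 → ℤ),
          c m' j * (dsym j (m.2 - m'.2) * c (m - m') p)) : ℂ³) =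
        if m.1 = 0 then mFourierCoeff (EuclideanSpace.complexify ∘ f) m.2 else 0) :
    (Continuous (fun t : ℝ => fun k : ↥(freqBall N : Finset (Fin 3 → ℤ)) =>
        ∑' n : ℤ, (fourier n (((ω * t : ℝ)) : UnitAddCircle) : ℂ) • c (n, (k : Fin 3 → ℤ)))) ∧
    (∀ t : ℝ, HasDerivAt (fun s : ℝ => fun k : ↥(freqBall N : Finset (Fin 3 → ℤ)) =>
        ∑' n : ℤ, (fourier n (((ω * s : ℝ)) : UnitAddCircle) : ℂ) • c (n, (k : Fin 3 → ℤ)))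
      (galerkinRHS (freqBall N) ν (fourierRestrict (freqBall N) f)
        (fun k : ↥(freqBall N : Finset (Fin 3 → ℤ)) =>
          ∑' n : ℤ, (fourier n (((ω * t : ℝ)) : UnitAddCircle) : ℂ) • c (n, (k : Fin 3 → ℤ)))) t) := by
  -- `hω`, `hcs` belong to the registered signature but are not needed for the identity
  have _h₁ := hω
  have _h₂ := hcs
  obtain ⟨-, hfib, hfib1⟩ := summable_fibre_of_rapidDecayE hcr
  have hD : ∀ t : ℝ, HasDerivAt (fun s : ℝ => fun k : ↥(freqBall N : Finset (Fin 3 → ℤ)) =>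
        ∑' n : ℤ, (fourier n (((ω * s : ℝ)) : UnitAddCircle) : ℂ) • c (n, (k : Fin 3 → ℤ)))
      (galerkinRHS (freqBall N) ν (fourierRestrict (freqBall N) f)
        (fun k : ↥(freqBall N : Finset (Fin 3 → ℤ)) =>
          ∑' n : ℤ, (fourier n (((ω * t : ℝ)) : UnitAddCircle) : ℂ) • c (n, (k : Fin 3 → ℤ)))) t := by
    intro t
    refine hasDerivAt_pi.2 fun k => ?_
    exact (hasDerivAt_tsum_fourier_smul (hfib (k : Fin 3 → ℤ)) (hfib1 (k : Fin 3 → ℤ)) ω t).congr_deriv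
      (timeSum_deriv_eq_galerkinRHS hf hf0 hc0 hct hcN hcr heq (((ω * t : ℝ)) : UnitAddCircle) k)
  exact ⟨continuous_iff_continuousAt.2 fun t => (hD t).continuousAt, hD⟩

end Stub


end Summit.AnomalousDissipation.AnomalousDissipation.Theorems.UniformWorkFloorTrap.WorkLipschitzCycles

end
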